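import Mathlib
import HarnessLib
import HarnessLib.Audit
import Summits.AtomisticToContinuum.Statement
import Literature.MathematicalPhysics.KineticTheory.LangevinChainNESSHolds
import HarnessLib.Audit.Status.Attr

/-!
Route: SpatialCentreManifold

# Route SpatialCentreManifold — Kirchgässner in space — Fourier's law as slow-manifold tracking of
the site-to-site transfer; R_N = (N-1)·r(T) + O(1) closes FouriersLaw

It suffices to show the AFFINE RESISTANCE LAW: for pinnedChain ω₂ lam β γ (all four > 0) and T > 0,
assuming uniqueness of the weak steady
state, there is a bulk resistivity r = r(T) > 0 such that for every steady-state family and every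
sequence D_N of finite-N linear-response
coefficients (D_N = lim_{δ→0,δ≠0} totalCurrent(μ_{N,T+δ/2,T−δ/2})/δ) the total thermal resistance
R_N := (N−1)/D_N satisfies
|R_N − (N−1)·r| ≤ C — Fourier's law WITH its finite-size law D_N = κ + O(1/N), κ(T) = 1/r(T).
Together with the two shared finite-N items
NessUnique (stmt-0741) and FiniteResponseOfUnique (stmt-0717) this decides FouriersLaw (deciding
theorem `closes`, 90 lines, axioms
propext/Classical.choice/Quot.sound). The line realises idea card spatial-dynamics-slow-manifold
("Kirchgässner in space"): treating the SITE
INDEX as time, the affine law is slow-manifold tracking of the spatial transfer 𝒮_* on stationary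
pair-path laws (landed:
`OscillatorChain.spatialTransfer`, fixed point `𝒮_* G_T = G_T` proved in
Literature/…/EquilibriumPairPathLaw), with the O(1) = the two contact
resistances = its stable/unstable fibres; the finer cruxes LocalFourierLaw (rank 2),
AdditiveContactResistance (4) and
BathIndependentResistivity (5) are the mechanism's fingerprints, each implying the affine law.
Lean: `∀ ω₂ lam β γ : ℝ, 0 < ω₂ → 0 < lam → 0 < β → 0 < γ → (∀ (N : ℕ) (T_L T_R : ℝ), 0 < T_L → 0 <
T_R → ∀ μ ν : MeasureTheory.Measure
(Literature.MathematicalPhysics.KineticTheory.HeatConduction.PhaseSpace N),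
(Literature.MathematicalPhysics.KineticTheory.HeatConduction.pinnedChain ω₂ lam β γ).IsSteadyState N
T_L T_R μ → (Literature.MathematicalPhysics.KineticTheory.HeatConduction.pinnedChain ω₂ lam β
γ).IsSteadyState N T_L T_R ν → μ = ν) → ∀ T : ℝ, 0 < T → ∃ r : ℝ, 0 < r ∧ ∀ μ : (N : ℕ) → ℝ → ℝ →
MeasureTheory.Measure (Literature.MathematicalPhysics.KineticTheory.HeatConduction.PhaseSpace N), (∀
(N : ℕ) (T_L T_R : ℝ), 0 < T_L → 0 < T_R →
(Literature.MathematicalPhysics.KineticTheory.HeatConduction.pinnedChain ω₂ lam β γ).IsSteadyState N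
T_L T_R (μ N T_L T_R)) → ∀ D : ℕ → ℝ, (∀ N : ℕ, Filter.Tendsto (fun δ : ℝ =>
(Literature.MathematicalPhysics.KineticTheory.HeatConduction.pinnedChain ω₂ lam β γ).totalCurrent (μ
N (T + δ / 2) (T - δ / 2)) / δ) (nhdsWithin 0 {(0 : ℝ)}ᶜ) (nhds (D N))) → ∃ C : ℝ, ∀ N : ℕ, |((N :
ℝ) - 1) / D N - ((N : ℝ) - 1) * r| ≤ C`

## Assembly
Ninety lines of logic and real analysis, certified (`ledger route check --native … --closes-file
glue.lean`; planner Sketch.lean rc 0, axioms propext/Classical.choice/Quot.sound): fix ω₂ lam β γ >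
0; clause (i) of FouriersLawFor: existence from the LANDED theorem
`Literature.MathematicalPhysics.KineticTheory.HeatConduction.pinnedChain_exists_isSteadyState` (CEHR
2018 Thm 2.13, all N incl. N = 0) and uniqueness from NessUnique; clause (ii): κ T := 1/r(T) with
r(T) = Classical.choose (AffineResistanceLaw … T) for T > 0 (κ T := 1 otherwise), κ T > 0; for a
family μ put D N := Classical.choose (FiniteResponseOfUnique … N); from |(N−1)/D_N − (N−1)r| ≤ C,
for (N−1)r > C the quotient is positive, so D_N ≠ 0 and |1/D_N − r| ≤ C/(N−1) → 0, hence D_N → 1/r =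
κ T (Tendsto.inv₀). The ranked cruxes #2, #4, #5 each imply #3 (items LocalLawToResistance;
one-liners additive_imp_affine / bathIndependent_imp_affine in the sketch).

Rationale: WHY THIS LINE. BonettoLebowitzReyBellet2000's limit (33) is "N iterations of one N-independent
object": since V′(r) = r + βr³ is a bijection, Newton's
equation at an interior site solved for q_{i+1} defines a deterministic spatial shift 𝒮 on pairs of
site-paths and a transfer map 𝒮_* on
time-stationary pair-path laws whose fixed points are the equilibrium laws {G_T} (proved:
`IsEquilibriumProcess.spatialTransfer_equilibriumPairPathLaw_pinnedChain`)
and for which the bond current J is an exact invariant; the N-site NESS is a two-point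
boundary-value problem of duration N with the Langevin
relations as boundary manifolds. Imported from dynamical systems: Kirchgässner's spatial dynamics
and centre-manifold reduction for lattices
(Kirchgassner1982, IoossKirchgassner2000, James2003, HaragusIooss2011 §5.2.3 — for FPU waves 0 is a
double eigenvalue plus a first integral,
verbatim the (T, J) block), normal hyperbolicity / slow manifolds in Banach space (Fenichel1979,
BatesLuZeng1998) and anisotropic spaces for
transfer operators (GouezelLiverani2005; cf. CanestrariLiveraniOlla2026 for the temporal version of
this technology on a chain); at kinetic
level it is Milne/Chapman–Enskog layer theory (BardosCaflischNicolaenko1986, CoronGolseSulem1988)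
and at stochastic level the matrix-product
picture of boundary-driven NESS (DerridaEtAl1993), lifted to the microscopic deterministic transfer.
It EXPLAINS the phenomenology — contact
temperature jumps ∝ J and κ_N = κ/(1 + ℓ/N) (AokiKusnezov2001, AokiKusnezov2002,
LepriLiviPoliti2003, Dhar2008) are the hyperbolic fibres and
the tracking error — and it differs from every open FouriersLaw route (FourierGreenKubo,
CurrentTiltQuench, OddSectorIrreversibility,
BondHeatUncertainty, PorousMediumCorner, KineticCorner: temporal decay / Green–Kubo / odd-sector /
anchor lines) in that the gap it bets on is
SPATIAL and at equilibrium, and N → ∞, the contact corrections and the finite-size law come from one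
normal form. Conforming re-filing of the
retired route SpatialSlowManifold (closed not-a-thesis 2026-08-15: no deciding theorem) with (i) a
certified `closes`, (ii) summable instead
of geometric contact layers in the rank-2 crux (robust to the diffusive pseudo-gap), (iii) the
convergent-contact-resistance crux replacing
the θ^N form. Negatives index: 6 refuted statements on the summit, none on FouriersLaw.

RANKED CRUXES. #2 LocalFourierLaw (crux) — LOCAL FOURIER LAW IN LINEAR RESPONSE WITH SUMMABLE
CONTACT LAYERS (card items 2–3, finite-N shadow of U1 SpatialSpectralGap + U2 SlowManifoldBVP). For
pinnedChain ω₂ lam β γ (all > 0), weak-NESS uniqueness, T > 0: there are r > 0 (bulk resistivity per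
bond) and a summable envelope a : ℕ → [0,∞) such that for every steady-state family μ and every N
the linear-response current ι_N (totalCurrent/δ → (N−1)ι_N as δ → 0, δ ≠ 0) and the
kinetic-temperature response profile τ_N(i) = lim (μ_{N,T+δ/2,T−δ/2}(p_i²) − T)/δ exist and
|τ_N(i+1) − τ_N(i) + r·ι_N| ≤ |ι_N|·(a_i + a_{N−2−i}) on every bond (i, i+1). On the slow manifold
T_{i+1} − T_i = −r(T_i)J exactly; deviations are transverse components of size O(J) excited at the
baths and contracting inwards (normal hyperbolicity ⇒ a_i = Cθ^i; a diffusive pseudo-gap would give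
a power law, still summable is the bet). N = 0, 1: vacuous (no bond; ι free). [difficulty:
open-problem] (why it might fail: Needs N-uniform SUMMABLE spatial relaxation to local equilibrium
at first order in δT: a hidden odd conserved charge (Mazur) or κ = ∞ kills it; layers with Σa = ∞
(diffusive pseudo-gap of 𝒮_*, thermal breathers at low T) break it while Fourier survives; τ-limits
unproved; false at lam = β = 0.) [AokiKusnezov2001, AokiKusnezov2002, EckmannYoung2005,
BricmontKupiainen2007, HaragusIooss2011, BardosCaflischNicolaenko1986,
Literature.Barriers.AtomisticToContinuum.HarmonicChainBallisticFlux]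
#3 AffineResistanceLaw (crux) — AFFINE RESISTANCE LAW (bounded contact correction) — the deciding
theorem's input. For pinnedChain (all > 0), weak-NESS uniqueness, T > 0: ∃ r > 0 such that for every
steady-state family μ and every D with D_N = lim_{δ→0,δ≠0} totalCurrent(μ_{N,T+δ/2,T−δ/2})/δ (all N)
there is C with |(N−1)/D_N − (N−1)·r| ≤ C for all N; i.e. R_N = (N−1)r + O(1), Fourier's law with
the finite-size rate D_N = κ + O(1/N), κ(T) = 1/r(T) (strictly stronger than clause (ii) of
FouriersLawFor, which has no rate). r is fixed before the family (κ must be), C after (μ, D) (under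
uniqueness the family is unique where it matters; this makes the glue from #2, #4, #5 one line
each). N = 0, 1: D_N = 0 and the term is |(N−1)r| ≤ r (Lean x/0 = 0). Implied by LocalFourierLaw +
BathFluxBalance (item LocalLawToResistance), by AdditiveContactResistance (convergent ⇒ bounded) and
by BathIndependentResistivity (instantiate γ) — planner sketch lemmas additive_imp_affine,
bathIndependent_imp_affine, rc 0. [difficulty: open-problem] (why it might fail: Even if D_N → κ ∈
(0,∞) (open), the contact correction R_N − (N−1)r may drift like log N or N^α (non-summable layers;
FPU-type anomalous boundary scaling); κ = ∞ (hidden odd charge, Mazur) or κ = 0 kills r > 0; no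
N-uniform bound of any kind is known (HasBoundedResponse).) [BonettoLebowitzReyBellet2000,
AokiKusnezov2001, Dhar2008, Literature.Barriers.AtomisticToContinuum.HasBoundedResponse,
Literature.Barriers.AtomisticToContinuum.Mazur1969_inequality]
#4 AdditiveContactResistance (crux) — RESISTANCE = BULK + TWO CONTACTS, up to o(1) (card item 3: the
two semi-infinite layer problems glued along the slow manifold). For pinnedChain (all > 0),
weak-NESS uniqueness, T > 0: ∃ r > 0, ∃ c such that for every steady-state family and every sequence
D of response coefficients, R_N − (N−1)·r → c as N → ∞ (R_N := (N−1)/D_N); c = c_L(γ,T) + c_R(γ,T) ≈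
2/γ + layer terms (T_L − ⟨p_0²⟩ = J/γ exactly). The D_N-only fingerprint of slow-manifold tracking
(a Fekete-type argument gives only R_N/N → r); gives the Aoki–Kusnezov finite-size law D_N = κN/(N +
ℓ) + o(1), ℓ = c/r − 1. Normal hyperbolicity predicts the rate |R_N − (N−1)r − c| ≤ Cθ^N (not
filed). Implies AffineResistanceLaw (convergent ⇒ bounded). [deps: AffineResistanceLaw] [difficulty:
open-problem] (why it might fail: Requires CONVERGENT contact corrections: the two semi-infinite
contact problems must have finite resistances c_L, c_R interacting o(1) across the bulk; bounded but
oscillating or slowly drifting corrections refute it with #3 intact; κ = ∞ or hidden charges kill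
r.) [AokiKusnezov2001, LepriLiviPoliti2003, BardosCaflischNicolaenko1986, CoronGolseSulem1988,
doi:10.1023/b:joss.0000037232.14365.10]
#5 BathIndependentResistivity (crux) — BATH-INDEPENDENT BULK RESISTIVITY (card: κ lives on the
centre manifold of the BATH-FREE transfer 𝒮_*; γ only moves the boundary manifolds B_L, B_R). For
ω₂, lam, β > 0 and T > 0 there is ONE r = r(ω₂, lam, β, T) > 0 such that for EVERY bath coupling γ >
0 (weak-NESS uniqueness for pinnedChain ω₂ lam β γ assumed), every steady-state family and every
sequence D of response coefficients, |(N−1)/D_N − (N−1)·r| ≤ C(γ, μ, D) for all N — κ_BLR(T) =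
1/r(T) does not depend on γ, only the contact correction does. Expected also from κ = κ_GK (route
FourierGreenKubo) but unproved for every Hamiltonian chain; finite-N data are γ-dependent (contact
resistance ~ 1/γ + layer term) — the claim is about the SLOPE in N. Implies AffineResistanceLaw for
each γ. [deps: AffineResistanceLaw] [difficulty: open-problem] (why it might fail: Bath-independence
of κ_BLR is unproved for every Hamiltonian chain (BLR §7: not even κ = κ_GK is clear); if N → ∞
selects a γ-dependent bulk closure (quasi-integrable windows, non-unique stationary closure) the
slope depends on γ while Fourier holds per γ.) [BonettoLebowitzReyBellet2000, Dhar2008,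
LepriLiviPoliti2003, AokiKusnezov2001, Literature.Barriers.AtomisticToContinuum.HasBoundedResponse]
#9 BathFluxBalance (support) — BATH FLUX BALANCE (provable now). For pinnedChain (all > 0), assuming
weak-NESS uniqueness: every weak steady state μ (IsSteadyState N T_L T_R; T_L, T_R > 0) has finite
second moments of the momenta; all bond currents have the same mean; ∫ j_0 dμ = γ(T_L − ∫ p_0² dμ)
(N ≥ 2) and ∫ j_{N−2} dμ = γ(∫ p_{N−1}² dμ − T_R). Proof route: by uniqueness μ is the CEHR state
(PROVED fact CuneoEckmannHairerReyBellet2018_pinnedChain_holds: e^{ϑH} ∈ L¹(μ)), so polynomial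
observables are integrable; extend ∫ Lf dμ = 0 from C_c^∞ to polynomially bounded smooth f by
cutoffs χ(H/R) and dominated convergence; then L(p_0²/2 + U(q_0) + ½V(q_1 − q_0)) = −j_0 + γ(T_L −
p_0²), interior site energies give ∫ j_{i−1} = ∫ j_i, and L(p_{N−1}²/2 + U(q_{N−1}) + ½V(q_{N−1} −
q_{N−2})) = j_{N−2} + γ(T_R − p_{N−1}²) (signs checked against `generator`/`bondCurrent`).
[difficulty: provable-now] [BonettoLebowitzReyBellet2000, CuneoEckmannHairerReyBellet2018,
Literature.MathematicalPhysics.KineticTheory.HeatConduction.CuneoEckmannHairerReyBellet2018_pinnedChain_holds]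
#9 LocalLawToResistance (support) — GLUE (provable now, real analysis): LocalFourierLaw →
BathFluxBalance → AffineResistanceLaw (the three statements expanded verbatim). Proof: fix
parameters, uniqueness, T > 0; take r, a from LocalFourierLaw, S := Σ a; given a family μ, D and N ≥
2, BathFluxBalance at (T+δ/2, T−δ/2) (|δ| < 2T suffices along 𝓝[≠] 0) gives equal bond currents, so
totalCurrent = (N−1)∫ j_0 (the last Fin index carries bondCurrent = 0), ∫ j_0/δ → γ(1/2 − τ_0) and ∫
j_{N−2}/δ → γ(τ_{N−1} + 1/2); uniqueness of limits gives D_N = (N−1)ι, ι = γ(1/2 − τ_0) = γ(τ_{N−1}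
+ 1/2). Telescoping: |τ_{N−1} − τ_0 + (N−1)rι| ≤ |ι|Σ_i(a_i + a_{N−2−i}) ≤ 2S|ι|, i.e. |(N−1)rι +
2ι/γ − 1| ≤ 2S|ι|; ι = 0 is impossible, so |1/ι − (N−1)r| ≤ 2S + 2/γ with (N−1)/D_N = 1/ι. N = 0, 1:
D_N = 0, term ≤ r. C := max(2S + 2/γ, r). [difficulty: provable-now] [folklore,
BonettoLebowitzReyBellet2000]
#9 NessUnique (support) — UNIQUENESS OF THE WEAK STEADY STATE (= stmt-AtomisticToContinuum-0741 of
route FourierGreenKubo, same signature): for pinnedChain ω₂ lam β γ (all > 0), every N and T_L, T_R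
> 0, any two measures in the weak Fokker–Planck class IsSteadyState coincide. Print: uniqueness of
the invariant measure of the Langevin semigroup (CuneoEckmannHairerReyBellet2018 Thm 2.13(1);
Carmona2007 Thm 1.1(iii)) + the FP-identification lemma (weak stationary solution ⇒ P_t-invariant).
With the PROVED existence fact it gives clause (i) of FouriersLawFor. [difficulty: L]
[CuneoEckmannHairerReyBellet2018, Carmona2007]
#9 FiniteResponseOfUnique (support) — FINITE-N LINEAR RESPONSE EXISTS (=
stmt-AtomisticToContinuum-0717 of route FourierGreenKubo, same signature): assuming weak-NESS
uniqueness, for every steady-state family, T > 0 and N the limit D_N = lim_{δ→0,δ≠0}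
totalCurrent(μ_{N,T+δ/2,T−δ/2})/δ exists (differentiability at equilibrium of NESS expectations of
the polynomial currents in the bath temperatures; ReyBellet2003 Rem 4.4, HairerMajda2009 Thm 2.3
framework). N = 0, 1: totalCurrent ≡ 0. [difficulty: L] [HairerMajda2009, ReyBellet2003]

TWO-LAYER PLAN. The UPPER LAYER of the card, to be filed by glued split of LocalFourierLaw once a
functional setting is typed (k = 3, depth 1):
LocalFourierLaw ⇐ SpatialSpectralGap → SlowManifoldBVP → NessTracksSlowManifold → LocalFourierLaw,
where
U1 SpatialSpectralGap: on an ANISOTROPIC Banach manifold 𝓟 of tempered time-stationary pair-path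
laws (landed carrier:
`SmoothPairPath.IsTemperedStationaryLaw`; norms pairing forward and backward spatial recursions —
𝒮_* is the push-forward by a G_T-preserving
INVERTIBLE map, measure-theoretically conjugate to the lattice shift of the Gibbs process, so on
densities it is unitary and a gap exists only
on adapted spaces, GouezelLiverani2005) the linearisation d𝒮_*|_{G_T} has spectrum {1} ∪ Σ, Σ off
the unit circle, generalised 1-eigenspace
two-dimensional (∂_T G_T and a current direction: a Jordan block, J shifts T); U2 SlowManifoldBVP:
persistence of the 2-D normally hyperbolic
slow manifold {G_{T,J}} with reduced map (T, J) ↦ (T − r(T)J + O(J²), J) (first order in J suffices: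
variation of constants along the
fixed-point curve) and solvability of the two-point BVP with the Langevin boundary manifolds
transversal to the stable/unstable foliations;
U3 NessTracksSlowManifold: the interior pair-path laws of the finite-N NESS ARE the BVP solution
(needs the stationary Langevin PROCESS path law,
cf. LangevinChainSDE/LangevinChainKernel). Also foreseen: AdditiveContactResistance ⇐ (left contact
problem) → (right contact problem) →
(exponentially small interaction); BathIndependentResistivity ⇐ U2 with γ entering only B_L, B_R.

KILL CRITERIA. (i) A second local conserved charge of the infinite pinned chain odd under p ↦ −p and
overlapping J (extra neutral direction of 𝒮_*; Mazur)
or a proof that κ = ∞: refutes #2–#5 at once → `close --reason refuted:AffineResistanceLaw`, card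
outcome refuted. (ii) Proof or certified
numerics that R_N − (N−1)r DRIFTS (log N, N^α) at some admissible (ω₂, lam, β, γ, T): refutes
AffineResistanceLaw (and #2, #4) while Fourier
may survive → close refuted; the card reverts to a polynomial-tracking variant only if D_N still
converges. (iii) R_N − (N−1)r bounded but
non-convergent: refutes #4 only → drop #4, keep the line. (iv) γ-dependence of the slope lim R_N/N:
refutes #5 → the 'bath-free centre
manifold' reading is dead; restate the thesis per γ (AffineResistanceLaw survives) or close if (ii)
also fires. (v) FourierGreenKubo's
ThermodynamicLimit + GreenKubo proved first: the route is not mooted (its items are strictly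
stronger: rates and contacts) but loses priority;
AffineResistanceLaw then reads as the finite-size theorem. (vi) NessUnique refuted (non-unique weak
steady states): every FouriersLaw route
breaks (clause (i) is part of the Statement) — not specific to this line.

NOT DECOMPOSED YET. The whole upper layer (U1–U3 above: the anisotropic functional setting for 𝒮_*,
the spectral statement, NHIM persistence à la
BatesLuZeng1998, the identification 'BVP solution = NESS pair marginals'); the exponential rate |R_N
− (N−1)r − c| ≤ Cθ^N and geometric
layers a_i = Cθ^i (the normally hyperbolic strong form — filed only if #2/#4 close or numerics show
geometric layers); r = 1/κ_GK
(contact with FourierGreenKubo); T-continuity of r; the low-temperature regime (r(T) → 0, ℓ → ∞ as T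
→ 0: nothing uniform in T is claimed);
the existence of the τ-limits as a separate finite-N item (it rides inside #2; HairerMajda2009-type
differentiability as for 0717).

CHEAPEST FALSIFIER. NESS numerics (kit, first refuter task; not runnable from this compute-free
plancard seat): pinnedChain with ω₂ = lam = β = γ = 1, T = 1,
δ = 0.2 symmetric (or the fixed-N equilibrium Green–Kubo formula for D_N), N = 4, 8, …, 128: (a)
residuals of R_N = (N−1)/D_N against
(N−1)r + c must be bounded and convergent (#3, #4) — a log N drift kills the line; (b) the profile
residuals τ(i+1) − τ(i) + rι, scaled by ι,
must have an N-independent summable envelope (#2); geometric decay θ^i supports U1, a power law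
i^{-s}, s > 1, supports only the pseudo-gap
reading; (c) repeat at γ = 0.2 and γ = 5: equal slopes r (#5). Calibration in print: for the
solvable harmonic chain with self-consistent
reservoirs (doi:10.1023/b:joss.0000037232.14365.10, Thm 3.1, §4.3 and Lemma 4.1) Fourier's law holds
with (N−1)J_N → κ·δT, a linear profile and
an exponentially decaying profile kernel — the spatial structure this line predicts; the
linear-algebra check 'exactly two unimodular
directions of the zero-frequency covariance transfer' there is the mechanism-level falsifier of U1.

NUMBERS. φ⁴/FPU-type pinned chains numerically: κ(N) = κ/(1 + ℓ/N)-type finite-size law with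
boundary jumps ∝ J (AokiKusnezov2001, AokiKusnezov2002);
contact resistance ∝ 1/γ at weak coupling and growing again at strong coupling (LepriLiviPoliti2003,
Dhar2008 §2.2); harmonic end point:
κ_N ∝ N, flat bulk profile (RiederLebowitzLieb1967;
Literature.Barriers.AtomisticToContinuum.HarmonicChainBallisticFlux); self-consistent
harmonic chain: κ = (ω²/λ)/(2 + ν² + √(ν²(4 + ν²))) with linear profile, corrections O(N^{-1/2})
(doi:10.1023/b:joss.0000037232.14365.10 §4.3).
Items at open: 9 (4 cruxes, 4 support, 1 assembly).

DEFINITION REQUESTS. None new. The gen-1 requests LANDED: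
`Literature.MathematicalPhysics.KineticTheory.HeatConduction.OscillatorChain.spatialShift`,
`.spatialTransfer`, `.equilibriumPairPathLaw`, `SmoothPairPath.IsTemperedStationaryLaw`,
`OscillatorChain.IsEquilibriumProcess` with the
proved fixed point `spatialTransfer_equilibriumPairPathLaw_pinnedChain`
(Literature/MathematicalPhysics/KineticTheory/EquilibriumPairPathLaw.lean).
What the upper layer still lacks is not a notion but a NORMED setting (anisotropic Banach manifold
of laws on which 𝒮_* is C¹) — to be
requested with the first glued split, not now.

Novelty: Searches (2026-08-15, this seat): `lit search --hybrid "temperature profile boundary layer contact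
resistance anharmonic chain heat baths
finite-size conductivity"` (10 rows, engineering heat-transfer textbooks only); `lit search --source
crossref "spatial dynamics center manifold
nonequilibrium steady state oscillator chain temperature profile"` (11 rows; nearest:
doi:10.1103/physrevlett.112.030603 Prosen 2014, exact
MPA steady state of an open chain — a quantum spatial-transfer construction); `lit galaxy search
"spatial dynamics" --star all` (36 rows, none
mathematical-physics), `lit galaxy search "Kirchgässner reduction" --star pdf` (1: arXiv:1610.07760,
ferrofluid free-surface spatial dynamics),
`lit galaxy search --star pdf --mode bm25 "contact resistance Fourier law anharmonic chain …"` (10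
rows, interface-engineering only);
`lit frontier AtomisticToContinuum --since 2021` (30 rows; relevant: CanestrariLiveraniOlla2026
arXiv:2310.13338 heat equation from a
deterministic chain with chaotic per-site forcing — temporal transfer-operator technology, not
spatial; arXiv:2604.14056 specific heat of
thermally driven chains); `lit bridges AtomisticToContinuum --cross any` (nothing on spatial
dynamics); `lit read arxiv:math-ph/0307035`
(BonettoLebowitzLukkarinen2004 pp. 3, 6–9: calibration model); openalex/arxiv legs rate-limited
(HTTP 429). Plus the card's own crossref ×4 /
hybrid searches and two refuter novelty audits (2026-08-15T04:23Z, 10:58Z).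
Nearest prior art found: Iooss  [refs: 10.1103/physrevlett.112.030603, 10.1007/s002200050821, 10.1007/s00332-002-0525-x, 10.1088/0305-4470/26/7/011, 1610.07760, 2310.13338, 2604.14056, math-ph/0307035, doi:10.1103/physrevlett.112.030603, arxiv:math-ph/0307035, doi:10.1007/s002200050821, doi:10.1007/s00332-002-0525-x, doi:10.1088/0305-4470/26/7/011, CanestrariLiveraniOlla2026, BonettoLebowitzLukkarinen2004, IoossKirchgassner2000, James2]

Barriers (technique_class: spatial-dynamics centre-manifold normal-hyperbolicity): - technique_class: spatial-dynamics centre-manifold normal-hyperbolicity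
- Literature.Barriers.AtomisticToContinuum.HasBoundedResponse: APPLIES in substance
(hasBoundedResponse_of_fouriersLawFor is proved; every typed crux asserts an N-UNIFORM r and
envelope — exactly what fixed-N tools CuneoEckmannHairerReyBellet2018 / Carmona2007 /
HairerMajda2009 cannot give). Evasion as designed: N is the number of iterations of ONE
N-independent object (the equilibrium transfer 𝒮_* and its hyperbolicity, U1); normally hyperbolic
BVP estimates are uniform in the time horizon; fixed-N theory is used only where allowed (existence
of the δ-limits, BathFluxBalance). Not evaded until U1 is a theorem — this is the bet.
- Literature.Barriers.AtomisticToContinuum.BeckerMenegaki2022_gapClosing: EVADED by construction —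
no temporal relaxation rate of the N-chain is used; the gap is SPATIAL (spectrum of d𝒮_*|_{G_T} off
the unit circle but for the 2-D centre), a property of the infinite equilibrium chain; the closing
temporal gap λ ≲ γ ln(2C)/√N is consistent with, indeed expected from, the neutral direction J.
- Literature.Barriers.AtomisticToContinuum.equilibrium_rate_bound: same as the parent entry
(SpectralGapClosingEquilibrium) — no N-uniform L²(μ) decay estimate for the energy observable enters
any item.
- Literature.Barriers.AtomisticToContinuum.Mazur1969_inequality: APPLIES, NOT evaded — an extensive
conserved charge of the infinite pinned chain, odd under p ↦ −p and overlapping J, is an extr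

sub-problem: FouriersLaw · status: open · opened planner-plancard-AtomisticToContinuum-Fourier-c4ceefcf-g2-0 2026-08-15T19:01:36Z · rev 0 · ledger route-AtomisticToContinuum-SpatialCentreManifold
GENERATED by the gate from the ledger (D-0016/17). Provers cite these decls: `theorem foo : Summit.AtomisticToContinuum.FouriersLaw.Theses.SpatialCentreManifold.<Decl> := …` in Summits/AtomisticToContinuum/FouriersLaw/Theorems/<Name>.lean.
-/

namespace Summit.AtomisticToContinuum.FouriersLaw.Theses.SpatialCentreManifold

open scoped BigOperators Topology Manifold Classical MeasureTheory ProbabilityTheory Matrix InnerProductSpace ComplexConjugate ContinuousMap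
open Filter Set Function TopologicalSpace MeasureTheory

attribute [summit_statement] _root_.FouriersLaw

/-- item stmt-AtomisticToContinuum-13406 · crux · rank 2 · open · by planner
why it might fail: Needs N-uniform SUMMABLE spatial relaxation to local equilibrium at first order in δT: a hidden odd conserved charge (Mazur) or κ = ∞ kills it; layers with Σa = ∞ (diffusive pseudo-gap of 𝒮_*, thermal breathers at low T) break it while Fourier survives; τ-limits unproved; false at lam = β = 0.
sources: AokiKusnezov2001, AokiKusnezov2002, EckmannYoung2005, BricmontKupiainen2007, HaragusIooss2011, BardosCaflischNicolaenko1986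
[crux] LOCAL FOURIER LAW IN LINEAR RESPONSE WITH SUMMABLE CONTACT LAYERS (card items 2–3, finite-N
shadow of U1 SpatialSpectralGap + U2 SlowManifoldBVP). For pinnedChain ω₂ lam β γ (all > 0),
weak-NESS uniqueness, T > 0: there are r > 0 (bulk resistivity per bond) and a summable envelope a :
ℕ → [0,∞) such that for every steady-state family μ and every N the linear-response current ι_N
(totalCurrent/δ → (N−1)ι_N as δ → 0, δ ≠ 0) and the kinetic-temperature response profile τ_N(i) =
lim (μ_{N,T+δ/2,T−δ/2}(p_i²) − T)/δ exist and |τ_N(i+1) − τ_N(i) + r·ι_N| ≤ |ι_N|·(a_i + a_{N−2−i})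
on every bond (i, i+1). On the slow manifold T_{i+1} − T_i = −r(T_i)J exactly; deviations are
transverse components of size O(J) excited at the baths and contracting inwards (normal
hyperbolicity ⇒ a_i = Cθ^i; a diffusive pseudo-gap would give a power law, still summable is the
bet). N = 0, 1: vacuous (no bond; ι free). [difficulty: open-problem] -/
@[route_item "route-AtomisticToContinuum-SpatialCentreManifold", crux]
def LocalFourierLaw : Prop :=
  ∀ ω₂ lam β γ : ℝ, 0 < ω₂ → 0 < lam → 0 < β → 0 < γ → (∀ (N : ℕ) (T_L T_R : ℝ), 0 < T_L → 0 < T_R → ∀ μ ν : MeasureTheory.Measure (Literature.MathematicalPhysics.KineticTheory.HeatConduction.PhaseSpace N), (Literature.MathematicalPhysics.KineticTheory.HeatConduction.pinnedChain ω₂ lam β γ).IsSteadyState N T_L T_R μ → (Literature.MathematicalPhysics.KineticTheory.HeatConduction.pinnedChain ω₂ lam β γ).IsSteadyState N T_L T_R ν → μ = ν) → ∀ T : ℝ, 0 < T → ∃ r : ℝ, 0 < r ∧ ∃ a : ℕ → ℝ, (∀ n : ℕ, 0 ≤ a n) ∧ Summable a ∧ ∀ μ : (N : ℕ) → ℝ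 → ℝ → MeasureTheory.Measure (Literature.MathematicalPhysics.KineticTheory.HeatConduction.PhaseSpace N), (∀ (N : ℕ) (T_L T_R : ℝ), 0 < T_L → 0 < T_R → (Literature.MathematicalPhysics.KineticTheory.HeatConduction.pinnedChain ω₂ lam β γ).IsSteadyState N T_L T_R (μ N T_L T_R)) → ∀ N : ℕ, ∃ ι : ℝ, ∃ τ : Fin N → ℝ, Filter.Tendsto (fun δ : ℝ => (Literature.MathematicalPhysics.KineticTheory.HeatConduction.pinnedChain ω₂ lam β γ).totalCurrent (μ N (T + δ / 2) (T - δ / 2)) / δ) (nhdsWithin 0 {(0 : ℝ)}ᶜ) (nhds (((N : ℝ) - 1) * ι)) ∧ (∀ i : Fin N, Filter.Tendsto (fun δ : ℝ => ((∫ x, (x.2 i) ^ 2 ∂(μ N (T + δ / 2) (T - δ / 2))) - T) / δ) (nhdsWithin 0 {(0 : ℝ)}ᶜ) (nhds (τ i))) ∧ ∀ i j : Fin N, j.val = i.val + 1 → |τ j - τ i + r * ι| ≤ |ι| * (a i.val + a (N - 1 - j.val))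

/-- item stmt-AtomisticToContinuum-13407 · crux · rank 3 · open · by planner
why it might fail: Even if D_N → κ ∈ (0,∞) (open), the contact correction R_N − (N−1)r may drift like log N or N^α (non-summable layers; FPU-type anomalous boundary scaling); κ = ∞ (hidden odd charge, Mazur) or κ = 0 kills r > 0; no N-uniform bound of any kind is known (HasBoundedResponse).
sources: BonettoLebowitzReyBellet2000, AokiKusnezov2001, Dhar2008, Literature.Barriers.AtomisticToContinuum.HasBoundedResponse, Literature.Barriers.AtomisticToContinuum.Mazur1969_inequality
[crux] AFFINE RESISTANCE LAW (bounded contact correction) — the deciding theorem's input. For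
pinnedChain (all > 0), weak-NESS uniqueness, T > 0: ∃ r > 0 such that for every steady-state family
μ and every D with D_N = lim_{δ→0,δ≠0} totalCurrent(μ_{N,T+δ/2,T−δ/2})/δ (all N) there is C with
|(N−1)/D_N − (N−1)·r| ≤ C for all N; i.e. R_N = (N−1)r + O(1), Fourier's law with the finite-size
rate D_N = κ + O(1/N), κ(T) = 1/r(T) (strictly stronger than clause (ii) of FouriersLawFor, which
has no rate). r is fixed before the family (κ must be), C after (μ, D) (under uniqueness the family
is unique where it matters; this makes the glue from #2, #4, #5 one line each). N = 0, 1: D_N = 0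
and the term is |(N−1)r| ≤ r (Lean x/0 = 0). Implied by LocalFourierLaw + BathFluxBalance (item
LocalLawToResistance), by AdditiveContactResistance (convergent ⇒ bounded) and by
BathIndependentResistivity (instantiate γ) — planner sketch lemmas additive_imp_affine,
bathIndependent_imp_affine, rc 0. [difficulty: open-problem] -/
@[route_item "route-AtomisticToContinuum-SpatialCentreManifold", crux]
def AffineResistanceLaw : Prop :=
  ∀ ω₂ lam β γ : ℝ, 0 < ω₂ → 0 < lam → 0 < β → 0 < γ → (∀ (N : ℕ) (T_L T_R : ℝ), 0 < T_L → 0 < T_R → ∀ μ ν : MeasureTheory.Measure (Literature.MathematicalPhysics.KineticTheory.HeatConduction.PhaseSpace N), (Literature.MathematicalPhysics.KineticTheory.HeatConduction.pinnedChain ω₂ lam β γ).IsSteadyState N T_L T_R μ → (Literature.MathematicalPhysics.KineticTheory.HeatConduction.pinnedChain ω₂ lam β γ).IsSteadyState N T_L T_R ν → μ = ν) → ∀ T : ℝ, 0 < T → ∃ r : ℝ, 0 < r ∧ ∀ μ : (N : ℕ) → ℝ → ℝ → MeasureTheory.Measure (Literature.MathematicalPhysics.KineticTheory.HeatConduction.PhaseSpace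 N), (∀ (N : ℕ) (T_L T_R : ℝ), 0 < T_L → 0 < T_R → (Literature.MathematicalPhysics.KineticTheory.HeatConduction.pinnedChain ω₂ lam β γ).IsSteadyState N T_L T_R (μ N T_L T_R)) → ∀ D : ℕ → ℝ, (∀ N : ℕ, Filter.Tendsto (fun δ : ℝ => (Literature.MathematicalPhysics.KineticTheory.HeatConduction.pinnedChain ω₂ lam β γ).totalCurrent (μ N (T + δ / 2) (T - δ / 2)) / δ) (nhdsWithin 0 {(0 : ℝ)}ᶜ) (nhds (D N))) → ∃ C : ℝ, ∀ N : ℕ, |((N : ℝ) - 1) / D N - ((N : ℝ) - 1) * r| ≤ C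

/-- item stmt-AtomisticToContinuum-13408 · crux · rank 4 · open · by planner
why it might fail: Requires CONVERGENT contact corrections: the two semi-infinite contact problems must have finite resistances c_L, c_R interacting o(1) across the bulk; bounded but oscillating or slowly drifting corrections refute it with #3 intact; κ = ∞ or hidden charges kill r.
sources: AokiKusnezov2001, LepriLiviPoliti2003, BardosCaflischNicolaenko1986, CoronGolseSulem1988, doi:10.1023/b:joss.0000037232.14365.10
[crux] RESISTANCE = BULK + TWO CONTACTS, up to o(1) (card item 3: the two semi-infinite layer
problems glued along the slow manifold). For pinnedChain (all > 0), weak-NESS uniqueness, T > 0: ∃ r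
> 0, ∃ c such that for every steady-state family and every sequence D of response coefficients, R_N
− (N−1)·r → c as N → ∞ (R_N := (N−1)/D_N); c = c_L(γ,T) + c_R(γ,T) ≈ 2/γ + layer terms (T_L − ⟨p_0²⟩
= J/γ exactly). The D_N-only fingerprint of slow-manifold tracking (a Fekete-type argument gives
only R_N/N → r); gives the Aoki–Kusnezov finite-size law D_N = κN/(N + ℓ) + o(1), ℓ = c/r − 1.
Normal hyperbolicity predicts the rate |R_N − (N−1)r − c| ≤ Cθ^N (not filed). Implies
AffineResistanceLaw (convergent ⇒ bounded). [deps: AffineResistanceLaw] [difficulty: open-problem] -/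
@[route_item "route-AtomisticToContinuum-SpatialCentreManifold", crux]
def AdditiveContactResistance : Prop :=
  ∀ ω₂ lam β γ : ℝ, 0 < ω₂ → 0 < lam → 0 < β → 0 < γ → (∀ (N : ℕ) (T_L T_R : ℝ), 0 < T_L → 0 < T_R → ∀ μ ν : MeasureTheory.Measure (Literature.MathematicalPhysics.KineticTheory.HeatConduction.PhaseSpace N), (Literature.MathematicalPhysics.KineticTheory.HeatConduction.pinnedChain ω₂ lam β γ).IsSteadyState N T_L T_R μ → (Literature.MathematicalPhysics.KineticTheory.HeatConduction.pinnedChain ω₂ lam β γ).IsSteadyState N T_L T_R ν → μ = ν) → ∀ T : ℝ, 0 < T → ∃ r : ℝ, 0 < r ∧ ∃ c : ℝ, ∀ μ : (N : ℕ) → ℝ → ℝ → MeasureTheory.Measure (Literature.MathematicalPhysics.KineticTheory.HeatConduction.PhaseSpace N), (∀ (N : ℕ) (T_L T_R : ℝ), 0 < T_L → 0 < T_R → (Literature.MathematicalPhysics.KineticTheory.HeatConduction.pinnedChain ω₂ lam β γ).IsSteadyState N T_L T_R (μ N T_L T_R)) → ∀ D : ℕ → ℝ, (∀ N : ℕ,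 Filter.Tendsto (fun δ : ℝ => (Literature.MathematicalPhysics.KineticTheory.HeatConduction.pinnedChain ω₂ lam β γ).totalCurrent (μ N (T + δ / 2) (T - δ / 2)) / δ) (nhdsWithin 0 {(0 : ℝ)}ᶜ) (nhds (D N))) → Filter.Tendsto (fun N : ℕ => ((N : ℝ) - 1) / D N - ((N : ℝ) - 1) * r) Filter.atTop (nhds c)

/-- item stmt-AtomisticToContinuum-13409 · crux · rank 5 · open · by planner
why it might fail: Bath-independence of κ_BLR is unproved for every Hamiltonian chain (BLR §7: not even κ = κ_GK is clear); if N → ∞ selects a γ-dependent bulk closure (quasi-integrable windows, non-unique stationary closure) the slope depends on γ while Fourier holds per γ.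
sources: BonettoLebowitzReyBellet2000, Dhar2008, LepriLiviPoliti2003, AokiKusnezov2001, Literature.Barriers.AtomisticToContinuum.HasBoundedResponse
[crux] BATH-INDEPENDENT BULK RESISTIVITY (card: κ lives on the centre manifold of the BATH-FREE
transfer 𝒮_*; γ only moves the boundary manifolds B_L, B_R). For ω₂, lam, β > 0 and T > 0 there is
ONE r = r(ω₂, lam, β, T) > 0 such that for EVERY bath coupling γ > 0 (weak-NESS uniqueness for
pinnedChain ω₂ lam β γ assumed), every steady-state family and every sequence D of response
coefficients, |(N−1)/D_N − (N−1)·r| ≤ C(γ, μ, D) for all N — κ_BLR(T) = 1/r(T) does not depend on γ,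
only the contact correction does. Expected also from κ = κ_GK (route FourierGreenKubo) but unproved
for every Hamiltonian chain; finite-N data are γ-dependent (contact resistance ~ 1/γ + layer term) —
the claim is about the SLOPE in N. Implies AffineResistanceLaw for each γ. [deps:
AffineResistanceLaw] [difficulty: open-problem] -/
@[route_item "route-AtomisticToContinuum-SpatialCentreManifold"]
def BathIndependentResistivity : Prop :=
  ∀ ω₂ lam β : ℝ, 0 < ω₂ → 0 < lam → 0 < β → ∀ T : ℝ, 0 < T → ∃ r : ℝ, 0 < r ∧ ∀ γ : ℝ, 0 < γ → (∀ (N : ℕ) (T_L T_R : ℝ), 0 < T_L → 0 < T_R → ∀ μ ν : MeasureTheory.Measure (Literature.MathematicalPhysics.KineticTheory.HeatConduction.PhaseSpace N), (Literature.MathematicalPhysics.KineticTheory.HeatConduction.pinnedChain ω₂ lam β γ).IsSteadyState N T_L T_R μ → (Literature.MathematicalPhysics.KineticTheory.HeatConduction.pinnedChain ω₂ lam β γ).IsSteadyState N T_L T_R ν → μ = ν) → ∀ μ : (N : ℕ) → ℝ → ℝ → MeasureTheory.Measure (Literature.MathematicalPhysics.KineticTheory.HeatConduction.PhaseSpace N),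 (∀ (N : ℕ) (T_L T_R : ℝ), 0 < T_L → 0 < T_R → (Literature.MathematicalPhysics.KineticTheory.HeatConduction.pinnedChain ω₂ lam β γ).IsSteadyState N T_L T_R (μ N T_L T_R)) → ∀ D : ℕ → ℝ, (∀ N : ℕ, Filter.Tendsto (fun δ : ℝ => (Literature.MathematicalPhysics.KineticTheory.HeatConduction.pinnedChain ω₂ lam β γ).totalCurrent (μ N (T + δ / 2) (T - δ / 2)) / δ) (nhdsWithin 0 {(0 : ℝ)}ᶜ) (nhds (D N))) → ∃ C : ℝ, ∀ N : ℕ, |((N : ℝ) - 1) / D N - ((N : ℝ) - 1) * r| ≤ C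

/-- item stmt-AtomisticToContinuum-0717 · support · rank 9 · open · by planner
sources: HairerMajda2009, ReyBellet2003
CONDITIONAL FORM OF 0705 (supersedes it as the prover target; refuters pool-5/g3-0: 0705 stand-alone
quantifies over EVERY steady-state family and is false-prone if weak steady states were non-unique):
assuming UNIQUENESS of weak steady states (IsSteadyState class) for pinnedChain at all N, T_L, T_R >
0, the finite-N linear-response limit D_N(T) = lim_{δ→0, δ≠0} totalCurrent(μ_{N,T+δ/2,T−δ/2})/δ
exists for every T > 0 and N. Content: differentiability at equilibrium of NESS expectations of the
polynomial currents in the bath temperatures (ReyBellet2003 arXiv:math-ph/0303021 Rem 4.4 (51)–(56)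
finite-volume Green–Kubo; HairerMajda2009 arXiv:0909.4313 Thm 2.3 framework — their SDE Thm 4.4
Assumption 5 fails here, so verify Assumptions 1–3 via CEHR2018 (2.5)/Carmona2007 Thm 1.1(iv)
weighted spectral gap). N = 0, 1: totalCurrent ≡ 0, D = 0. Together with 0706 gives 0705. -/
@[route_item "route-AtomisticToContinuum-SpatialCentreManifold", crux]
def FiniteResponseOfUnique : Prop :=
  ∀ ω₂ lam β γ : ℝ, 0 < ω₂ → 0 < lam → 0 < β → 0 < γ → (∀ (N : ℕ) (T_L T_R : ℝ), 0 < T_L → 0 < T_R → ∀ μ ν : MeasureTheory.Measure (Literature.MathematicalPhysics.KineticTheory.HeatConduction.PhaseSpace N), (Literature.MathematicalPhysics.KineticTheory.HeatConduction.pinnedChain ω₂ lam β γ).IsSteadyState N T_L T_R μ → (Literature.MathematicalPhysics.KineticTheory.HeatConduction.pinnedChain ω₂ lam β γ).IsSteadyState N T_L T_R ν → μ = ν) → ∀ μ : (N : ℕ) → ℝ → ℝ → MeasureTheory.Measure (Literature.MathematicalPhysics.KineticTheory.HeatConduction.PhaseSpace N), (∀ (N : ℕ) (T_L T_R : ℝ),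 0 < T_L → 0 < T_R → (Literature.MathematicalPhysics.KineticTheory.HeatConduction.pinnedChain ω₂ lam β γ).IsSteadyState N T_L T_R (μ N T_L T_R)) → ∀ T : ℝ, 0 < T → ∀ N : ℕ, ∃ D : ℝ, Filter.Tendsto (fun δ : ℝ => (Literature.MathematicalPhysics.KineticTheory.HeatConduction.pinnedChain ω₂ lam β γ).totalCurrent (μ N (T + δ / 2) (T - δ / 2)) / δ) (nhdsWithin 0 {(0 : ℝ)}ᶜ) (nhds D)

/-- item stmt-AtomisticToContinuum-0741 · support · rank 9 · open · by planner
sources: CuneoEckmannHairerReyBellet2018, Carmona2007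
[crux] UNIQUENESS OF THE WEAK STEADY STATE (the half of stmt-0706 not covered by the landed fact
Literature.MathematicalPhysics.KineticTheory.HeatConduction.CuneoEckmannHairerReyBellet2018_pinnedChain,
p3544): for pinnedChain ω₂ lam β γ (all > 0), every N and T_L, T_R > 0, any two measures in the weak
Fokker–Planck class IsSteadyState (probability, ∫ L f dμ = 0 for f ∈ C_c^∞, bond currents
integrable) coincide. Print: uniqueness of the INVARIANT MEASURE of the Langevin semigroup
(CuneoEckmannHairerReyBellet2018 Thm 2.13(1): C1, C2, CA; Carmona2007 Thm 1.1(iii)); the item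
additionally needs 'weak stationary probability solution of L*μ = 0 ⇒ P_t-invariant' for this
hypoelliptic L with cubic drift (Echeverría 1982 well-posed martingale problem on C_c^∞ +
non-explosion via e^{θH}; Bogachev–Krylov–Röckner–Shaposhnikov 2015 Ch. 5 is non-degenerate only) —
the FP-identification lemma is the formal crux. N = 0: PhaseSpace 0 is a point (unique probability
measure); N = 1: both baths on site 0, OU at temperature (T_L+T_R)/2. This is exactly the hypothesis
of FiniteResponse and ThermodynamicLimit and, with the fact, gives clause (i) of FouriersLawFor. -/
@[route_item "route-AtomisticToContinuum-SpatialCentreManifold"]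
def NessUnique : Prop :=
  ∀ ω₂ lam β γ : ℝ, 0 < ω₂ → 0 < lam → 0 < β → 0 < γ → ∀ (N : ℕ) (T_L T_R : ℝ), 0 < T_L → 0 < T_R → ∀ μ ν : MeasureTheory.Measure (Literature.MathematicalPhysics.KineticTheory.HeatConduction.PhaseSpace N), (Literature.MathematicalPhysics.KineticTheory.HeatConduction.pinnedChain ω₂ lam β γ).IsSteadyState N T_L T_R μ → (Literature.MathematicalPhysics.KineticTheory.HeatConduction.pinnedChain ω₂ lam β γ).IsSteadyState N T_L T_R ν → μ = ν

/-- item stmt-AtomisticToContinuum-13410 · support · rank 9 · open · by planner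
sources: BonettoLebowitzReyBellet2000, CuneoEckmannHairerReyBellet2018, Literature.MathematicalPhysics.KineticTheory.HeatConduction.CuneoEckmannHairerReyBellet2018_pinnedChain_holds
[support] BATH FLUX BALANCE (provable now). For pinnedChain (all > 0), assuming weak-NESS
uniqueness: every weak steady state μ (IsSteadyState N T_L T_R; T_L, T_R > 0) has finite second
moments of the momenta; all bond currents have the same mean; ∫ j_0 dμ = γ(T_L − ∫ p_0² dμ) (N ≥ 2)
and ∫ j_{N−2} dμ = γ(∫ p_{N−1}² dμ − T_R). Proof route: by uniqueness μ is the CEHR state (PROVED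
fact CuneoEckmannHairerReyBellet2018_pinnedChain_holds: e^{ϑH} ∈ L¹(μ)), so polynomial observables
are integrable; extend ∫ Lf dμ = 0 from C_c^∞ to polynomially bounded smooth f by cutoffs χ(H/R) and
dominated convergence; then L(p_0²/2 + U(q_0) + ½V(q_1 − q_0)) = −j_0 + γ(T_L − p_0²), interior site
energies give ∫ j_{i−1} = ∫ j_i, and L(p_{N−1}²/2 + U(q_{N−1}) + ½V(q_{N−1} − q_{N−2})) = j_{N−2} +
γ(T_R − p_{N−1}²) (signs checked against `generator`/`bondCurrent`). [difficulty: provable-now] -/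
@[route_item "route-AtomisticToContinuum-SpatialCentreManifold"]
def BathFluxBalance : Prop :=
  ∀ ω₂ lam β γ : ℝ, 0 < ω₂ → 0 < lam → 0 < β → 0 < γ → (∀ (N : ℕ) (T_L T_R : ℝ), 0 < T_L → 0 < T_R → ∀ μ ν : MeasureTheory.Measure (Literature.MathematicalPhysics.KineticTheory.HeatConduction.PhaseSpace N), (Literature.MathematicalPhysics.KineticTheory.HeatConduction.pinnedChain ω₂ lam β γ).IsSteadyState N T_L T_R μ → (Literature.MathematicalPhysics.KineticTheory.HeatConduction.pinnedChain ω₂ lam β γ).IsSteadyState N T_L T_R ν → μ = ν) → ∀ (N : ℕ) (T_L T_R : ℝ), 0 < T_L → 0 < T_R → ∀ μ : MeasureTheory.Measure (Literature.MathematicalPhysics.KineticTheory.HeatConduction.PhaseSpace N), (Literature.MathematicalPhysics.KineticTheory.HeatConduction.pinnedChain ω₂ lam β γ).IsSteadyState N T_L T_R μ → (∀ i : Fin N, MeasureTheory.Integrable (fun x : Literature.MathematicalPhysics.KineticTheory.HeatConduction.PhaseSpace N => (x.2 i) ^ 2) μ) ∧ (∀ i j : Fin N, i.val + 1 < N → j.val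 + 1 < N → ∫ x, (Literature.MathematicalPhysics.KineticTheory.HeatConduction.pinnedChain ω₂ lam β γ).bondCurrent N i x ∂μ = ∫ x, (Literature.MathematicalPhysics.KineticTheory.HeatConduction.pinnedChain ω₂ lam β γ).bondCurrent N j x ∂μ) ∧ (∀ i : Fin N, i.val = 0 → i.val + 1 < N → ∫ x, (Literature.MathematicalPhysics.KineticTheory.HeatConduction.pinnedChain ω₂ lam β γ).bondCurrent N i x ∂μ = γ * (T_L - ∫ x, (x.2 i) ^ 2 ∂μ)) ∧ (∀ i j : Fin N, j.val = i.val + 1 → j.val + 1 = N → ∫ x, (Literature.MathematicalPhysics.KineticTheory.HeatConduction.pinnedChain ω₂ lam β γ).bondCurrent N i x ∂μ = γ * ((∫ x, (x.2 j) ^ 2 ∂μ) - T_R))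

/-- item stmt-AtomisticToContinuum-13411 · support · rank 9 · open · by planner
sources: folklore, BonettoLebowitzReyBellet2000
[support] GLUE (provable now, real analysis): LocalFourierLaw → BathFluxBalance →
AffineResistanceLaw (the three statements expanded verbatim). Proof: fix parameters, uniqueness, T >
0; take r, a from LocalFourierLaw, S := Σ a; given a family μ, D and N ≥ 2, BathFluxBalance at
(T+δ/2, T−δ/2) (|δ| < 2T suffices along 𝓝[≠] 0) gives equal bond currents, so totalCurrent = (N−1)∫
j_0 (the last Fin index carries bondCurrent = 0), ∫ j_0/δ → γ(1/2 − τ_0) and ∫ j_{N−2}/δ → γ(τ_{N−1}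
+ 1/2); uniqueness of limits gives D_N = (N−1)ι, ι = γ(1/2 − τ_0) = γ(τ_{N−1} + 1/2). Telescoping:
|τ_{N−1} − τ_0 + (N−1)rι| ≤ |ι|Σ_i(a_i + a_{N−2−i}) ≤ 2S|ι|, i.e. |(N−1)rι + 2ι/γ − 1| ≤ 2S|ι|; ι =
0 is impossible, so |1/ι − (N−1)r| ≤ 2S + 2/γ with (N−1)/D_N = 1/ι. N = 0, 1: D_N = 0, term ≤ r. C
:= max(2S + 2/γ, r). [difficulty: provable-now] -/
@[route_item "route-AtomisticToContinuum-SpatialCentreManifold"]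
def LocalLawToResistance : Prop :=
  (∀ ω₂ lam β γ : ℝ, 0 < ω₂ → 0 < lam → 0 < β → 0 < γ → (∀ (N : ℕ) (T_L T_R : ℝ), 0 < T_L → 0 < T_R → ∀ μ ν : MeasureTheory.Measure (Literature.MathematicalPhysics.KineticTheory.HeatConduction.PhaseSpace N), (Literature.MathematicalPhysics.KineticTheory.HeatConduction.pinnedChain ω₂ lam β γ).IsSteadyState N T_L T_R μ → (Literature.MathematicalPhysics.KineticTheory.HeatConduction.pinnedChain ω₂ lam β γ).IsSteadyState N T_L T_R ν → μ = ν) → ∀ T : ℝ, 0 < T → ∃ r : ℝ, 0 < r ∧ ∃ a : ℕ → ℝ, (∀ n : ℕ, 0 ≤ a n) ∧ Summable a ∧ ∀ μ : (N : ℕ) → ℝ → ℝ → MeasureTheory.Measure (Literature.MathematicalPhysics.KineticTheory.HeatConduction.PhaseSpace N), (∀ (N : ℕ) (T_L T_R : ℝ), 0 < T_L → 0 < T_R → (Literature.MathematicalPhysics.KineticTheory.HeatConduction.pinnedChain ω₂ lam β γ).IsSteadyState N T_L T_R (μ N T_L T_R)) → ∀ N : ℕ, ∃ ι : ℝ, ∃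 τ : Fin N → ℝ, Filter.Tendsto (fun δ : ℝ => (Literature.MathematicalPhysics.KineticTheory.HeatConduction.pinnedChain ω₂ lam β γ).totalCurrent (μ N (T + δ / 2) (T - δ / 2)) / δ) (nhdsWithin 0 {(0 : ℝ)}ᶜ) (nhds (((N : ℝ) - 1) * ι)) ∧ (∀ i : Fin N, Filter.Tendsto (fun δ : ℝ => ((∫ x, (x.2 i) ^ 2 ∂(μ N (T + δ / 2) (T - δ / 2))) - T) / δ) (nhdsWithin 0 {(0 : ℝ)}ᶜ) (nhds (τ i))) ∧ ∀ i j : Fin N, j.val = i.val + 1 → |τ j - τ i + r * ι| ≤ |ι| * (a i.val + a (N - 1 - j.val))) → (∀ ω₂ lam β γ : ℝ, 0 < ω₂ → 0 < lam → 0 < β → 0 < γ → (∀ (N : ℕ) (T_L T_R : ℝ), 0 < T_L → 0 < T_R → ∀ μ ν : MeasureTheory.Measure (Literature.MathematicalPhysics.KineticTheory.HeatConduction.PhaseSpace N), (Literature.MathematicalPhysics.KineticTheory.HeatConduction.pinnedChain ω₂ lam β γ).IsSteadyState N T_L T_R μ → (Literature.MathematicalPhysics.KineticTheory.HeatConduction.pinnedChain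 ω₂ lam β γ).IsSteadyState N T_L T_R ν → μ = ν) → ∀ (N : ℕ) (T_L T_R : ℝ), 0 < T_L → 0 < T_R → ∀ μ : MeasureTheory.Measure (Literature.MathematicalPhysics.KineticTheory.HeatConduction.PhaseSpace N), (Literature.MathematicalPhysics.KineticTheory.HeatConduction.pinnedChain ω₂ lam β γ).IsSteadyState N T_L T_R μ → (∀ i : Fin N, MeasureTheory.Integrable (fun x : Literature.MathematicalPhysics.KineticTheory.HeatConduction.PhaseSpace N => (x.2 i) ^ 2) μ) ∧ (∀ i j : Fin N, i.val + 1 < N → j.val + 1 < N → ∫ x, (Literature.MathematicalPhysics.KineticTheory.HeatConduction.pinnedChain ω₂ lam β γ).bondCurrent N i x ∂μ = ∫ x, (Literature.MathematicalPhysics.KineticTheory.HeatConduction.pinnedChain ω₂ lam β γ).bondCurrent N j x ∂μ) ∧ (∀ i : Fin N, i.val = 0 → i.val + 1 < N → ∫ x, (Literature.MathematicalPhysics.KineticTheory.HeatConduction.pinnedChain ω₂ lam β γ).bondCurrent N i x ∂μ = γ * (T_L - ∫ x, (x.2 i) ^ 2 ∂μ)) ∧ (∀ i j : Fin N, j.val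 = i.val + 1 → j.val + 1 = N → ∫ x, (Literature.MathematicalPhysics.KineticTheory.HeatConduction.pinnedChain ω₂ lam β γ).bondCurrent N i x ∂μ = γ * ((∫ x, (x.2 j) ^ 2 ∂μ) - T_R))) → (∀ ω₂ lam β γ : ℝ, 0 < ω₂ → 0 < lam → 0 < β → 0 < γ → (∀ (N : ℕ) (T_L T_R : ℝ), 0 < T_L → 0 < T_R → ∀ μ ν : MeasureTheory.Measure (Literature.MathematicalPhysics.KineticTheory.HeatConduction.PhaseSpace N), (Literature.MathematicalPhysics.KineticTheory.HeatConduction.pinnedChain ω₂ lam β γ).IsSteadyState N T_L T_R μ → (Literature.MathematicalPhysics.KineticTheory.HeatConduction.pinnedChain ω₂ lam β γ).IsSteadyState N T_L T_R ν → μ = ν) → ∀ T : ℝ, 0 < T → ∃ r : ℝ, 0 < r ∧ ∀ μ : (N : ℕ) → ℝ → ℝ → MeasureTheory.Measure (Literature.MathematicalPhysics.KineticTheory.HeatConduction.PhaseSpace N), (∀ (N : ℕ) (T_L T_R : ℝ), 0 < T_L → 0 < T_R → (Literature.MathematicalPhysics.KineticTheory.HeatConduction.pinnedChain ω₂ lam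 β γ).IsSteadyState N T_L T_R (μ N T_L T_R)) → ∀ D : ℕ → ℝ, (∀ N : ℕ, Filter.Tendsto (fun δ : ℝ => (Literature.MathematicalPhysics.KineticTheory.HeatConduction.pinnedChain ω₂ lam β γ).totalCurrent (μ N (T + δ / 2) (T - δ / 2)) / δ) (nhdsWithin 0 {(0 : ℝ)}ᶜ) (nhds (D N))) → ∃ C : ℝ, ∀ N : ℕ, |((N : ℝ) - 1) / D N - ((N : ℝ) - 1) * r| ≤ C)

/-- item stmt-AtomisticToContinuum-13412 · assembly · rank 1 · open · by planner
sources: BonettoLebowitzReyBellet2000, CuneoEckmannHairerReyBellet2018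
[assembly] NessUnique → FiniteResponseOfUnique → AffineResistanceLaw → FouriersLaw (the curried type
of `closes`). -/
@[route_item "route-AtomisticToContinuum-SpatialCentreManifold"]
def Assembly : Prop :=
  NessUnique → FiniteResponseOfUnique → AffineResistanceLaw → _root_.FouriersLaw

/-! D-0027 §2.1 — DECIDING THEOREM (planner-authored via `route open/edit --closes-file`; by planner-plancard-AtomisticToContinuum-Fourier-c4ceefcf-g2-0 2026-08-15T19:01:37Z):
its hypotheses are this route's items and its conclusion the sub-problem Statement (glue_lint), and it elaborates with this file. -/

@[closes "route-AtomisticToContinuum-SpatialCentreManifold"] theorem closes (hNU : NessUnique) (hFR : FiniteResponseOfUnique) (hA : AffineResistanceLaw) :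
    _root_.FouriersLaw := by
  intro ω₂ lam β γ hω hl hβ hγ
  have huniq := hNU ω₂ lam β γ hω hl hβ hγ
  refine ⟨?_, ?_⟩
  · -- clause (i): existence (landed: CEHR 2018 Thm 2.13, all N) + uniqueness (item NessUnique)
    intro N T_L T_R hL hR
    obtain ⟨μ, hμ⟩ :=
      Literature.MathematicalPhysics.KineticTheory.HeatConduction.pinnedChain_exists_isSteadyState
        hω hl hβ hγ N hL hR
    exact ⟨μ, hμ, fun ν hν => huniq N T_L T_R hL hR ν μ hν hμ⟩
  · -- clause (ii): κ T := 1 / r(T) with r(T) the bulk resistivity of item AffineResistanceLaw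
    classical
    have hr : ∀ T : ℝ, 0 < T → _ := fun T hT => hA ω₂ lam β γ hω hl hβ hγ huniq T hT
    let r : ℝ → ℝ := fun T => if hT : 0 < T then Classical.choose (hr T hT) else 1
    have hrpos : ∀ T, 0 < T → 0 < r T := fun T hT => by
      simp only [r, dif_pos hT]
      exact (Classical.choose_spec (hr T hT)).1
    refine ⟨fun T => 1 / r T, fun T hT => one_div_pos.2 (hrpos T hT), ?_⟩
    intro μ hμ T hT
    have hD := hFR ω₂ lam β γ hω hl hβ hγ huniq μ hμ T hT
    set D : ℕ → ℝ := fun N => Classical.choose (hD N) with hDdef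
    have hDspec : ∀ N : ℕ, Filter.Tendsto (fun δ : ℝ =>
        (Literature.MathematicalPhysics.KineticTheory.HeatConduction.pinnedChain ω₂ lam β γ).totalCurrent
          (μ N (T + δ / 2) (T - δ / 2)) / δ) (nhdsWithin 0 {(0 : ℝ)}ᶜ) (nhds (D N)) :=
      fun N => Classical.choose_spec (hD N)
    refine ⟨D, hDspec, ?_⟩
    have hρ : 0 < r T := hrpos T hT
    obtain ⟨C, hC'⟩ : ∃ C : ℝ, ∀ N : ℕ, |((N : ℝ) - 1) / D N - ((N : ℝ) - 1) * r T| ≤ C := by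
      have h2 := (Classical.choose_spec (hr T hT)).2 μ hμ D hDspec
      simp only [r, dif_pos hT]
      exact h2
    set ρ := r T with hρdef
    -- eventually: D N ≠ 0 and |1 / D N - ρ| ≤ C / (N - 1)
    have hN1 : Filter.Tendsto (fun N : ℕ => (N : ℝ) - 1) Filter.atTop Filter.atTop :=
      Filter.tendsto_atTop_add_const_right _ (-1) tendsto_natCast_atTop_atTop |>.congr
        (fun N => by ring)
    have h0 : Filter.Tendsto (fun N : ℕ => C / ((N : ℝ) - 1)) Filter.atTop (nhds 0) :=
      tendsto_const_nhds.div_atTop hN1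
    have hev : ∀ᶠ N : ℕ in Filter.atTop, C / ρ + 1 ≤ (N : ℝ) - 1 :=
      Filter.tendsto_atTop.1 hN1 (C / ρ + 1)
    have hkey : ∀ᶠ N : ℕ in Filter.atTop, D N ≠ 0 ∧ |1 / D N - ρ| ≤ C / ((N : ℝ) - 1) := by
      filter_upwards [hev] with N hN
      have hn : (0 : ℝ) < (N : ℝ) - 1 := by
        have : 0 ≤ C / ρ + 1 - 1 := by
          have hCnn : 0 ≤ C := le_trans (abs_nonneg _) (hC' 0)
          have : 0 ≤ C / ρ := div_nonneg hCnn hρ.le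
          linarith
        linarith [this]
      have hgt : C < ((N : ℝ) - 1) * ρ := by
        have h1 : C / ρ < (N : ℝ) - 1 := by linarith
        have := (div_lt_iff₀ hρ).1 h1
        linarith [this]
      have hb := hC' N
      have hxpos : 0 < ((N : ℝ) - 1) / D N := by
        have := abs_sub_le_iff.1 hb
        linarith [this.1, this.2]
      have hDne : D N ≠ 0 := by
        intro h
        rw [h, div_zero] at hxpos
        exact lt_irrefl _ hxpos
      refine ⟨hDne, ?_⟩
      have hrew : 1 / D N - ρ = (((N : ℝ) - 1) / D N - ((N : ℝ) - 1) * ρ) / ((N : ℝ) - 1) := by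
        field_simp
      rw [hrew, abs_div, abs_of_pos hn]
      exact div_le_div_of_nonneg_right hb hn.le
    -- hence 1 / D N → ρ
    have hinv : Filter.Tendsto (fun N : ℕ => 1 / D N) Filter.atTop (nhds ρ) := by
      have hup : Filter.Tendsto (fun N : ℕ => ρ + C / ((N : ℝ) - 1)) Filter.atTop (nhds ρ) := by
        simpa using tendsto_const_nhds.add h0
      have hlo : Filter.Tendsto (fun N : ℕ => ρ - C / ((N : ℝ) - 1)) Filter.atTop (nhds ρ) := by
        simpa using tendsto_const_nhds.sub h0
      refine tendsto_of_tendsto_of_tendsto_of_le_of_le' hlo hup ?_ ?_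
      · filter_upwards [hkey] with N hN
        have := abs_sub_le_iff.1 hN.2
        linarith [this.1, this.2]
      · filter_upwards [hkey] with N hN
        have := abs_sub_le_iff.1 hN.2
        linarith [this.1, this.2]
    -- and D N = (1 / D N)⁻¹ eventually
    have hinv' : Filter.Tendsto (fun N : ℕ => (1 / D N)⁻¹) Filter.atTop (nhds ρ⁻¹) :=
      hinv.inv₀ hρ.ne'
    have heq : (fun N : ℕ => (1 / D N)⁻¹) = D := by
      funext N
      simp
    rw [heq] at hinv'
    simpa [one_div] using hinv'

end Summit.AtomisticToContinuum.FouriersLaw.Theses.SpatialCentreManifold
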